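import Literature.AnabelianGeometry.AbsoluteAnabelian.AbsTopII.EllipticCuspidalizationCanonicalPinScope

/-!
# [AbsTopII] Cor 3.3 (iii)(a): a record REALIZING the printed chain has a NON-injective cuspidalization
# for `N ≥ 2` (non-degeneracy of `EllipticCuspidalization.RealizesChain`)

S. Mochizuki, *Topics in Absolute Anabelian Geometry II* [AbsTopII] (bib `MochizukiAbsTopII2013`), §3,
Ex 3.2 (i)(ii) pp. 66–67 (the chain `X ⇝ V ⇝ D ⇝ U ⇝ U_{N²−1} ⇝ ⋯ ⇝ U_1 = D`, "`N² − 1` de-cuspidalization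
operations"), Cor 3.3 (iii)(a) p. 68 ("such that the natural surjection `Π_U ↠ Π_D` may be recovered from the
chain of •'s terminating at the third to last group"); [AbsTopI] (`MochizukiAbsTopI2012`) Def 4.2 (iii)(c)
pp. 49–50 (type •: "a surjection `Πⱼ ↠ Πⱼ₊₁` such that `Ker` is topologically normally generated by a
cuspidal decomposition group `C` in `Δⱼ`"; condition (3_Π): "a *nontrivial* image … of the decomposition
group in `Δ` of a cusp").

PROOF-ONLY file (no definition, no instance, no named `Prop` fact), abc-iut cell, seat abc-iut-L6-t2 (gen 3),
row «REFISELLIPTIC-R2-CHAIN» of abc-iut-L6-lead §F v1.19at (2)/§F v1.19at-ter (1), L4 vocabulary only.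
Consumed BY NAME, nothing restated: abc-iut-L4-t6's `EllipticCuspidalization.RealizesChain`
(`AbsTopII/EllipticCuspidalizationContent.lean`), `ChainGroup.ne_bot_of_mem_cuspidalDecompGroups` and
`PiChain.psi_eq_one_of_first_step` (`AbsTopII/EllipticCuspidalizationCanonicalPinScope.lean`), the record
fields `glue` / `glue_comm` / `toCore_isOpenInjective` of `AbsTopII.EllipticCuspidalization`
(`AbsTopII/EllipticCuspidalization.lean`).

WHAT IS PROVED.  For a record `K : AbsTopII.EllipticCuspidalization E` with `2 ≤ K.N` (so the •-block of the
recorded type-chain has `N² − 1 ≥ 3 ≥ 1` steps) that REALIZES the printed chain relative to ANY cuspidal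
data `CD` (`K.RealizesChain S CD hP hΔ hne`):

* `RealizesChain.exists_ne_one_projU_eq_one` — some `x ≠ 1` of `Π_U` lies in the kernel of the output's
  `Π_U ↠ Π_D` (`K.projU`): the first • step `φ_s : Π_s ↠ Π_{s+1}` kills its (3_Π) cuspidal decomposition group
  `D ≠ ⊥`, the kill propagates along the •-block to `Π_t`, and the LAST clause of `RealizesChain`
  ("`eD⁻¹ ∘ ψ_t = projU`", a GLOBAL identity — no open-subgroup / finite-index detour as in
  `not_realizesChainPinned_of_two_le`) carries it to `projU`;
* `RealizesChain.projU_not_injective_of_two_le` — hence `Π_U ↠ Π_D` is NOT injective;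
* `RealizesChain.proj_not_injective_of_two_le` — and neither is THE OUTPUT `Π_{U_X} ↠ Π'` (`K.proj`): through
  the fibre-product identification `glue` / `glue_comm` of Cor 3.3 (iii)(a)(b) and the injectivity of
  `Π' ↪ Π_C` (`toCore_isOpenInjective`), an injective `proj` would make `projU` injective on the kernel
  element above.

USE (L6 side, same row): the identity witness of abc-iut-L6-t21's finding A21g10-F1
(`MonoThetaProjectiveProp16EllipticRefIdentityWitness.lean`, p447116: `projU := toCore E`, injective; `proj = 𝟙`)
therefore realizes NO chain of level `N ≥ 2`; the strengthened successor predicate `RefIsEllipticChain` of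
[IUTchII] Prop 1.6 (ii) (`MonoThetaProjectiveProp16EllipticRefChain.lean`) is not inhabited by it.
HONEST FRAMING: an elementary statement about OUR typed output structure; nothing in print is contradicted or
endorsed; no side taken on [IUTchIII] Cor 3.12; typed ≠ proved.
-/

open Topology

universe u

namespace Literature.AnabelianGeometry.AbsoluteAnabelian.AbsTopII.EllipticCuspidalization

open Literature.AlgebraicGeometry.Frobenioids (IsSlimGroup)
open FundamentalExtension

variable {E : FundamentalExtension.{u}} {K : EllipticCuspidalization E} {S : Set ℕ}
  {CD : CuspidalData E} {hP : IsSlimGroup E.arith} {hΔ : IsSlimGroup E.geom} {hne : E.geom ≠ ⊥}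

/-- **Cor 3.3 (iii)(a) + [AbsTopI] Def 4.2 (iii)(c), (3_Π)**: if the record realizes the printed chain and
`N ≥ 2` (at least one de-cuspidalization step `U_1 ⇝ D`), then some nontrivial element of `Π_U` is killed by
`Π_U ↠ Π_D` — the (3_Π) cuspidal decomposition group of the first • step is nontrivial and lies in the kernel of
the •-composite, which IS `projU` by the last clause of `RealizesChain`.
[cite: MochizukiAbsTopII2013, Cor 3.3 (iii)(a) p.68] -/
theorem RealizesChain.exists_ne_one_projU_eq_one (h : K.RealizesChain S CD hP hΔ hne) (h2 : 2 ≤ K.N) :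
    ∃ x : K.cuspU.arith, x ≠ 1 ∧ K.projU.arith x = 1 := by
  obtain ⟨c, -, -, -, s, t, v, hst, htv, hvl, eU, eD, eV, gU, gD, gV, ψ, -, -, -, hψs, hsteps, hlast⟩ := h
  -- `N ≥ 2` gives at least one • step: `s < t`
  have hN : 1 ≤ K.N ^ 2 - 1 := by
    have : 2 ^ 2 ≤ K.N ^ 2 := Nat.pow_le_pow_left h2 2
    omega
  have hlt : s.val < t.val := by omega
  have hslen : s.val < c.len := by omega
  -- the first • step `φs : Π_s ↠ Π_{s+1}` with its (3_Π) group `D ≠ ⊥`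
  set js : Fin c.len := ⟨s.val, hslen⟩ with hjs
  obtain ⟨φs, hde, hψ1⟩ := hsteps js (le_refl _) hlt
  obtain ⟨-, -, D, hDmem, hker, -⟩ := hde
  have hDne : D ≠ ⊥ := ChainGroup.ne_bot_of_mem_cuspidalDecompGroups hDmem
  obtain ⟨y, hyD, hy1⟩ : ∃ y ∈ D, y ≠ 1 := by
    by_contra hall
    push Not at hall
    exact hDne ((Subgroup.eq_bot_iff_forall _).mpr hall)
  have hDker : φs y = 1 := by
    have hy' : y ∈ φs.toMonoidHom.ker := by
      rw [hker]
      exact Subgroup.le_topologicalClosure _ (Subgroup.le_normalClosure hyD)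
    exact hy'
  refine ⟨eU.symm y, fun h0 => hy1 ?_, ?_⟩
  · -- `eU⁻¹ y = 1 ⇒ y = 1`
    have h0' := congrArg eU h0
    rwa [ContinuousMulEquiv.apply_symm_apply, map_one] at h0'
  · -- `φs (eU (eU⁻¹ y)) = φs y = 1 ⇒ ψ_{s+1} (eU⁻¹ y) = 1 ⇒ ψ_t (eU⁻¹ y) = 1 ⇒ projU (eU⁻¹ y) = 1`
    have hs1 : s.val + 1 < c.len + 1 := by omega
    have hφs : ∀ x, φs (eU x) = 1 → ψ js.succ x = 1 := by
      intro x hx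
      have hcast : ψ js.castSucc x = eU x := hψs x
      rw [hψ1 x, hcast, hx]
    have hzero : ψ t (eU.symm y) = 1 :=
      c.psi_eq_one_of_first_step s t eU ψ hsteps hs1 φs hφs (K.N ^ 2 - 1 - 1) t (by omega) le_rfl _
        (by rw [ContinuousMulEquiv.apply_symm_apply]; exact hDker)
    have hl := hlast (eU.symm y)
    rw [hzero, map_one] at hl
    rw [← hl]
    rfl

/-- **Non-degeneracy of the chain conjunct, `Π_U ↠ Π_D`**: a record realizing the printed chain with `N ≥ 2`
has NON-injective `projU`. [cite: MochizukiAbsTopII2013, Cor 3.3 (iii)(a) p.68] -/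
theorem RealizesChain.projU_not_injective_of_two_le (h : K.RealizesChain S CD hP hΔ hne) (h2 : 2 ≤ K.N) :
    ¬ Function.Injective K.projU.arith := by
  intro hinj
  obtain ⟨x, hx1, hx⟩ := h.exists_ne_one_projU_eq_one h2
  exact hx1 (hinj (by rw [hx, map_one]))

/-- **Non-degeneracy of the chain conjunct, THE OUTPUT `Π_{U_X} ↠ Π'`**: a record realizing the printed chain
with `N ≥ 2` has NON-injective `proj` — through the fibre product "`Π_{U_V} ↠ Π_V` … recovered from `Π_U ↠ Π_D`
by forming the fibre product with `Π_V ↪ Π_D`" (`glue`, `glue_comm`) and the open injection `Π' ↪ Π_C`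
(`toCore`): the kernel element of `projU` lies over `1 ∈ Π_V`, so it is `glue z` for some `z ∈ Π_{U_V}` with
`toCore (proj z) = projU (glue z) = 1`, whence `proj z = 1`, `z = 1` if `proj` were injective, and the kernel
element would be `1`. In particular an ISOMORPHISM `Π_{U_X} ⥲ Π'` (e.g. the identity) realizes no chain of
level `≥ 2`. [cite: MochizukiAbsTopII2013, Cor 3.3 (iii)(a)(b) pp.68-69] -/
theorem RealizesChain.proj_not_injective_of_two_le (h : K.RealizesChain S CD hP hΔ hne) (h2 : 2 ≤ K.N) :
    ¬ Function.Injective K.proj.arith := by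
  intro hinj
  obtain ⟨x, hx1, hx⟩ := h.exists_ne_one_projU_eq_one h2
  -- `x` lies over `1 ∈ toCore(Π_V)`, hence in the target of `glue`
  have hxmem : x ∈ (K.PiV.map K.toCore.arith.toMonoidHom).comap K.projU.arith.toMonoidHom := by
    rw [Subgroup.mem_comap]
    change K.projU.arith x ∈ _
    rw [hx]
    exact Subgroup.one_mem _
  obtain ⟨z, hz⟩ : ∃ z, K.glue z = ⟨x, hxmem⟩ := K.glue.surjective ⟨x, hxmem⟩
  have hcomm := K.glue_comm z
  rw [hz] at hcomm
  change K.toCore.arith (K.proj.arith (z : K.cuspUX.arith)) = K.projU.arith x at hcomm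
  rw [hx] at hcomm
  -- `toCore` injective ⇒ `proj z = 1`; `proj` injective ⇒ `z = 1`
  have hpz : K.proj.arith (z : K.cuspUX.arith) = 1 :=
    K.toCore_isOpenInjective.arith_injective (by rw [hcomm, map_one])
  have hz1 : (z : K.cuspUX.arith) = 1 := hinj (by rw [hpz, map_one])
  have hz1' : z = 1 := Subtype.ext hz1
  apply hx1
  have hxz : x = ((K.glue z : ↥((K.PiV.map K.toCore.arith.toMonoidHom).comap K.projU.arith.toMonoidHom)) :
      K.cuspU.arith) := by
    rw [hz]
  rw [hxz, hz1', map_one]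
  rfl

end Literature.AnabelianGeometry.AbsoluteAnabelian.AbsTopII.EllipticCuspidalization
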